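import Literature.MathematicalPhysics.QuantumFieldTheory.Balaban1983to89.Missing
import Literature.MathematicalPhysics.QuantumFieldTheory.Balaban1983to89.Step
import Literature.MathematicalPhysics.QuantumFieldTheory.Balaban1983to89.UnitaryModel

/-!
# `Balaban1983to89.MissingProofs` — regularity lemmas for the torus expectations of `Missing`

Companion (proofs only, no new definitions, no named facts) of
`Literature.MathematicalPhysics.QuantumFieldTheory.Balaban1983to89.Missing` (audit cell `pub-balaban`, unit
`b2b-balaban-strat`, deliverable C = `MISSING.md`).  CITATION HEADER: nothing here is taken from or attributed to
T. Bałaban's series (CMP 1984–89) or to the Clay descriptions; these are [folklore] measure-theoretic facts about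
Wilson's lattice gauge theory on the finite tori `T^{(0)}` of `Setup` (`GaugeField P 0 G`, `fieldMeasure` = finite
product of the Haar probability measure, `wilsonAction4 ≥ 0`), proved so that the compactness bookkeeping of `Missing`
(`hasSubseqContinuumLimit_of_bounded`, `hasContinuumLimit_iff`) applies to schemes of normalised Wilson loops WITHOUT a
boundedness hypothesis:

* measurability of bond evaluation, plaquette variables, the Wilson action, loop holonomies, Wilson loop and plaquette
  observables and the Boltzmann weight, under `[MeasurableMul₂ G] [MeasurableInv G]` and `Measurable reTr`
  (true for closed subgroups of `U(N)` with their Borel structure);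
* `isProbabilityMeasure_fieldMeasure`; for `β ≥ 0`: `integrable_boltzmann`, `partitionFn_pos` (`Z > 0`),
  `abs_integral_mul_boltzmann_le` (`|∫ F e^{−βA}| ≤ Z` for `|F| ≤ 1`), `abs_expect_le_one` (`|⟨F⟩| ≤ 1`) — so the
  documented junk values of `Missing.partitionFn` / `Missing.expect` do not occur in this regime;
* `TorusScheme.abs_expectAt_le_one`, `TorusScheme.hasSubseqContinuumLimit` (subsequential continuum limits of all joint
  expectations exist for every scheme of observables bounded by `1` with `β_K ≥ 0` — Jaffe–Witten's excluded
  "weak-existence (compactness)", fn. 2, now hypothesis-free), `TorusScheme.hasContinuumLimit_iff_hasUniqueLimitPoints`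
  (for such schemes the open content of the finite-torus continuum limit is uniqueness of the limit points —
  Magnen–Rivasseau–Sénéor, CMP 155 (1993) p. 326: "the limit is not necessarily unique").

* (v1.1, after `Step` landed) `B12Thm2Shape_of_betaBounds`: the census field `Missing.BeyondUVStability.couplingFlow`
  (= `Missing.B12Thm2Shape`, [Balaban1987RG1] Thm 2 as a shape) FOLLOWS, for every flow map that is forward-generated
  from its bare coupling by the renormalization group equations (0.20) (B12 p. 259: "the sequence of the effective
  coupling constants g_k generated from the bare coupling constant g₀ by the renormalization group equations"), from
  continuity of the β-functions on `]0, γ₀]` and the two-sided bounds `0 < b ≤ β_j ≤ b'` there (`Step.BetaLower`,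
  `Step.BetaUpper`) — by f2's kernel-checked `Step.couplingTrajectory_exists` plus forward uniqueness of (0.20).  The
  printed half of the hypotheses is B12 p. 264 ("smooth … uniformly bounded"); the unprinted half is the uniform
  positive lower bound (the cell's MISSING.md §A1 "(β-AF)", GAPS G1/G-f2.2/G-strat-1).  This is a REDUCTION, not a proof
  of Theorem 2: (β-AF) is asserted by no printed source.

* (v1.2, after f1's `UnitaryModel` landed) the regularity hypotheses by INSTANCE: with `[RegularGaugeGroup G]` (a Prop-mixin
  carrying `MeasurableMul₂`, `MeasurableInv`, `Measurable reTr`, `|reTr| ≤ 1`; instances for `U(n)`, `SU(n)`) the primed lemmas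
  `partitionFn_pos'`, `abs_expect_le_one'`, `abs_expect_wilsonLoop_le_one`, `TorusScheme.hasSubseqContinuumLimit'` need no `hre`,
  and for schemes OF WILSON LOOPS (`obs K o = c · W_γ`, `|c| ≤ 1`) `TorusScheme.hasSubseqContinuumLimit_of_wilsonLoops` /
  `hasContinuumLimit_iff_of_wilsonLoops` leave only `β_K ≥ 0`.  Two pieces of flow arithmetic recorded for the cell's referee
  audit (REFEREE.md R6.2, R6.3): `discrete031_iff_suffix_sums` (along a solution of (0.20) the discrete (0.31) is EQUIVALENT to
  two-sided bounds on the suffix sums `Σ_{j∈[k,K)} β_{j+1}(g_j)`), `discrete031_not_pointwise` (a solution of (0.20) obeying (0.31)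
  with `b = 1 > 0` whose first increment `β_1(g_0)` is `0`: (0.31) does not force a pointwise lower bound on the β-functions, so
  (β-AF) is SUFFICIENT for Theorem 2, and what Theorem 2 forces is only the averaged bound), and `le_mul_iff_partialSum_ge` (the
  last inequality of B14 (2.6), `g_m ≤ (1+β₀) g_n`, ⇔ `Σ_{j∈[m,n)} β_{j+1}(g_j) ≥ −((1+β₀)² − 1)/g_m²`).

Nothing about the dynamics (no estimate of the series) is used; value = removing hypotheses from bookkeeping, NOT
progress on any open statement.
-/

open MeasureTheory Filter Topology
open scoped BigOperators

namespace Literature.MathematicalPhysics.QuantumFieldTheory.Balaban1983to89.Missing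

/-! ## Regularity (proved): for Wilson-loop schemes the compactness half is hypothesis-free

Under the standard measurability of the group operations (`MeasurableMul₂ G`, `MeasurableInv G`) and of the interface
function `reTr`, and for non-negative inverse couplings `β`, the torus expectation of any observable bounded by `1` is
bounded by `1` (`Z > 0` and `|∫ F e^{−βA}| ≤ Z`); hence `hasSubseqContinuumLimit_of_bounded` applies with `M = 1` to
every scheme of observables bounded by `1` (normalised Wilson loops when `|reTr| ≤ 1`), and for such schemes the open
content of `HasContinuumLimit` is exactly `HasUniqueLimitPoints` (`TorusScheme.hasContinuumLimit_iff_hasUniqueLimitPoints`).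
Elementary measure theory on the finite product of Haar probability measures; nothing about the dynamics is used. -/

section Pointwise

variable {G : Type*} [GaugeGroup G]

/-- The Boltzmann weight is positive. [folklore] -/
theorem boltzmann_pos (P : Params) (β : ℝ) (U : GaugeField P 0 G) : 0 < boltzmann P β U :=
  Real.exp_pos _

/-- For `β ≥ 0` the Boltzmann weight is at most `1` (the Wilson action is non-negative). [folklore] -/
theorem boltzmann_le_one (P : Params) {β : ℝ} (hβ : 0 ≤ β) (U : GaugeField P 0 G) : boltzmann P β U ≤ 1 :=
  Real.exp_le_one_iff.mpr (mul_nonpos_of_nonpos_of_nonneg (neg_nonpos.mpr hβ) (wilsonAction4_nonneg U))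

/-- `|W_γ| ≤ 1` for a normalised trace with `|reTr| ≤ 1` (a hypothesis: `GaugeGroup` records only `reTr ≤ 1`; it holds
for `G ⊂ U(N)` with `reTr = N⁻¹ Re tr`). [folklore] -/
theorem abs_wilsonLoop_le_one {P : Params} (hre1 : ∀ g : G, |reTr g| ≤ 1) (U : GaugeField P 0 G)
    (γ : List (PathStep P)) : |wilsonLoop U γ| ≤ 1 :=
  hre1 _

omit [GaugeGroup G] in
/-- Products of observables bounded by `1` are bounded by `1`. [folklore] -/
theorem abs_prod_obs_le_one {O : Type*} (S : TorusScheme G O) (h1 : ∀ K o U, |S.obs K o U| ≤ 1) (K : ℕ)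
    (os : List O) (U : GaugeField (S.P K) 0 G) : |(os.map fun o => S.obs K o U).prod| ≤ 1 := by
  induction os with
  | nil => simp
  | cons o os ih =>
    rw [List.map_cons, List.prod_cons, abs_mul]
    exact mul_le_one₀ (h1 K o U) (abs_nonneg _) ih

end Pointwise

section Measurability

variable {G : Type*} [GaugeGroup G] [MeasurableSpace G]

omit [GaugeGroup G] in
/-- Evaluation of a configuration at a bond is measurable (product σ-algebra). [folklore] -/
theorem measurable_eval {P : Params} {j : ℕ} (b : PBond P j) : Measurable fun U : GaugeField P j G => U b :=
  measurable_pi_apply b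

omit [GaugeGroup G] in
/-- Products of measurable observables are measurable. [folklore] -/
theorem measurable_prod_obs {O : Type*} (S : TorusScheme G O) (hm : ∀ K o, Measurable (S.obs K o)) (K : ℕ)
    (os : List O) : Measurable fun U : GaugeField (S.P K) 0 G => (os.map fun o => S.obs K o U).prod := by
  induction os with
  | nil => simp
  | cons o os ih =>
    show Measurable fun U : GaugeField (S.P K) 0 G => S.obs K o U * (os.map fun o => S.obs K o U).prod
    exact (hm K o).mul ih

variable [MeasurableMul₂ G] [MeasurableInv G]

/-- The plaquette variable `U ↦ U(∂p)` is measurable. [folklore] -/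
theorem measurable_plaqHol {P : Params} {j : ℕ} (p : Plaq P j) :
    Measurable fun U : GaugeField P j G => GaugeField.plaqHol U p := by
  unfold GaugeField.plaqHol
  exact (((measurable_eval _).mul (measurable_eval _)).mul (measurable_eval _).inv).mul
    (measurable_eval _).inv

/-- The Wilson action is measurable once `reTr` is. [folklore] -/
theorem measurable_wilsonAction4 {P : Params} {j : ℕ} (hre : Measurable (reTr : G → ℝ)) :
    Measurable fun U : GaugeField P j G => wilsonAction4 U := by
  unfold wilsonAction4 wilsonAction
  refine Finset.measurable_sum _ fun p _ => ?_
  exact measurable_const.mul (measurable_const.sub (hre.comp (measurable_plaqHol p)))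

/-- The plaquette observable is measurable once `reTr` is. [folklore] -/
theorem measurable_plaqLoop {P : Params} (hre : Measurable (reTr : G → ℝ)) (p : Plaq P 0) :
    Measurable (plaqLoop (G := G) p) :=
  hre.comp (measurable_plaqHol p)

/-- Holonomies along lattice paths are measurable. [folklore] -/
theorem measurable_pathHol {P : Params} (γ : List (PathStep P)) :
    Measurable fun U : GaugeField P 0 G => pathHol U γ := by
  induction γ with
  | nil => simp [pathHol]
  | cons s γ ih =>
    obtain ⟨b, f⟩ := s
    have hs : Measurable fun U : GaugeField P 0 G => (if f then U b else (U b)⁻¹ : G) := by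
      cases f
      · exact (measurable_eval (G := G) b).inv
      · exact measurable_eval (G := G) b
    show Measurable fun U : GaugeField P 0 G => (if f then U b else (U b)⁻¹ : G) * pathHol U γ
    exact hs.mul ih

/-- Wilson loop variables are measurable once `reTr` is. [folklore] -/
theorem measurable_wilsonLoop {P : Params} (hre : Measurable (reTr : G → ℝ)) (γ : List (PathStep P)) :
    Measurable fun U : GaugeField P 0 G => wilsonLoop U γ :=
  hre.comp (measurable_pathHol γ)

/-- The Boltzmann weight is measurable once `reTr` is. [folklore] -/
theorem measurable_boltzmann (hre : Measurable (reTr : G → ℝ)) (P : Params) (β : ℝ) :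
    Measurable (boltzmann (G := G) P β) := by
  unfold boltzmann
  exact (measurable_const.mul (measurable_wilsonAction4 hre)).exp

end Measurability

section Integrals

variable {G : Type*} [GaugeGroup G] [MeasurableSpace G] [HaarData G]

/-- The product Haar measure on configurations of `T^{(j)}` is a probability measure. [folklore] -/
theorem isProbabilityMeasure_fieldMeasure (P : Params) (j : ℕ) : IsProbabilityMeasure (fieldMeasure P j G) := by
  haveI : IsProbabilityMeasure (HaarData.haar (G := G)) := HaarData.isProb
  exact Measure.pi.instIsProbabilityMeasure (fun _ : PBond P j => (HaarData.haar : Measure G))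

variable [MeasurableMul₂ G] [MeasurableInv G]

/-- For `β ≥ 0` the Boltzmann weight is integrable. [folklore] -/
theorem integrable_boltzmann (hre : Measurable (reTr : G → ℝ)) (P : Params) {β : ℝ} (hβ : 0 ≤ β) :
    Integrable (boltzmann (G := G) P β) (fieldMeasure P 0 G) := by
  haveI := isProbabilityMeasure_fieldMeasure (G := G) P 0
  refine (integrable_const (1 : ℝ)).mono' (measurable_boltzmann hre P β).aestronglyMeasurable
    (Eventually.of_forall fun U => ?_)
  rw [Real.norm_eq_abs, abs_of_pos (boltzmann_pos P β U)]
  exact boltzmann_le_one P hβ U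

/-- **`Z > 0`** for `β ≥ 0`. [folklore] -/
theorem partitionFn_pos (hre : Measurable (reTr : G → ℝ)) (P : Params) {β : ℝ} (hβ : 0 ≤ β) :
    0 < partitionFn (G := G) P β := by
  haveI := isProbabilityMeasure_fieldMeasure (G := G) P 0
  have hsupp : Function.support (boltzmann (G := G) P β) = Set.univ :=
    Set.eq_univ_of_forall fun U => (boltzmann_pos P β U).ne'
  rw [partitionFn, integral_pos_iff_support_of_nonneg (fun U => (boltzmann_pos P β U).le)
    (integrable_boltzmann hre P hβ), hsupp, measure_univ]
  exact one_pos

/-- `|∫ F e^{−βA}| ≤ Z` for `|F| ≤ 1`, `β ≥ 0` (no measurability of `F` needed: a non-integrable integrand has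
integral `0`). [folklore] -/
theorem abs_integral_mul_boltzmann_le (hre : Measurable (reTr : G → ℝ)) (P : Params) {β : ℝ} (hβ : 0 ≤ β)
    {F : GaugeField P 0 G → ℝ} (hF1 : ∀ U, |F U| ≤ 1) :
    |∫ U, F U * boltzmann P β U ∂fieldMeasure P 0 G| ≤ partitionFn (G := G) P β := by
  rw [partitionFn, ← Real.norm_eq_abs]
  refine norm_integral_le_of_norm_le (integrable_boltzmann hre P hβ) (Eventually.of_forall fun U => ?_)
  rw [Real.norm_eq_abs, abs_mul, abs_of_pos (boltzmann_pos P β U)]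
  exact mul_le_of_le_one_left (boltzmann_pos P β U).le (hF1 U)

/-- **`|⟨F⟩| ≤ 1`** for `|F| ≤ 1`, `β ≥ 0`. [folklore] -/
theorem abs_expect_le_one (hre : Measurable (reTr : G → ℝ)) (P : Params) {β : ℝ} (hβ : 0 ≤ β)
    {F : GaugeField P 0 G → ℝ} (hF1 : ∀ U, |F U| ≤ 1) : |expect (G := G) P β F| ≤ 1 := by
  have hZ := partitionFn_pos (G := G) hre P hβ
  rw [expect, abs_div, abs_of_pos hZ, div_le_one hZ]
  exact abs_integral_mul_boltzmann_le hre P hβ hF1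

variable {O : Type*}

/-- **Joint expectations of observables bounded by `1` are bounded by `1`** (e.g. normalised Wilson loops with
`|reTr| ≤ 1`), for `β_K ≥ 0`, measurable `reTr` and group operations. [folklore] -/
theorem TorusScheme.abs_expectAt_le_one (S : TorusScheme G O) (hre : Measurable (reTr : G → ℝ))
    (hβ : ∀ K, 0 ≤ S.β K) (h1 : ∀ K o U, |S.obs K o U| ≤ 1) (K : ℕ) (os : List O) :
    |S.expectAt K os| ≤ 1 :=
  abs_expect_le_one hre (S.P K) (hβ K) (abs_prod_obs_le_one S h1 K os)

/-- **For such schemes subsequential continuum limits exist unconditionally** — the "weak-existence (compactness)"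
of Jaffe–Witten fn. 2, with no hypothesis on the lattice theory left. [folklore] -/
theorem TorusScheme.hasSubseqContinuumLimit [Countable O] (S : TorusScheme G O)
    (hre : Measurable (reTr : G → ℝ)) (hβ : ∀ K, 0 ≤ S.β K) (h1 : ∀ K o U, |S.obs K o U| ≤ 1) :
    HasSubseqContinuumLimit S :=
  hasSubseqContinuumLimit_of_bounded S 1 (S.abs_expectAt_le_one hre hβ h1)

/-- **… so the open content of the continuum limit on the torus is the uniqueness of the limit points** (MRS p. 326:
"the limit is not necessarily unique. Clearly this is a point which requires further work"). [folklore] -/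
theorem TorusScheme.hasContinuumLimit_iff_hasUniqueLimitPoints [Countable O] (S : TorusScheme G O)
    (hre : Measurable (reTr : G → ℝ)) (hβ : ∀ K, 0 ≤ S.β K) (h1 : ∀ K o U, |S.obs K o U| ≤ 1) :
    HasContinuumLimit S ↔ HasUniqueLimitPoints S := by
  rw [hasContinuumLimit_iff S 1 (S.abs_expectAt_le_one hre hβ h1)]
  exact ⟨fun h => h.2, fun h => ⟨S.hasSubseqContinuumLimit hre hβ h1, h⟩⟩

end Integrals

/-! ## Theorem 2's shape from β-function bounds, for forward-generated flows (REDUCTION; the lower bound is unprinted)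

[Balaban1987RG1] p. 259: "The second [aspect] concerns the behavior of the sequence of the effective coupling constants
g_k generated from the bare coupling constant g₀ by the renormalization group equations (0.18), (0.20)."  p. 264: the
β-functions are "smooth … (or analytic), uniformly bounded on this interval together with all derivatives. We will
investigate other properties in a separate paper."  The theorem below shows, kernel-checked, that the ONLY further
property Theorem 2 needs is a uniform positive lower bound (`Step.BetaLower b γ₀ β`, `b > 0`). -/

section FlowReduction

/-- **[Balaban1987RG1] Thm 2 (as the shape `B12Thm2Shape`) ⇐ continuity ∧ `0 < b ≤ β_j ≤ b'` on `]0, γ₀]`, for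
forward-generated flows.**  Hypotheses on the flow map `flowOf P g₀` (the couplings the construction generates at
parameters `P` from the bare coupling `g₀`): `h0` — it starts at `g₀`; `hfwd` — whenever `g_k > 0` and the right side
of (0.20), `1/g_k² − β_{k+1}(g_k)`, is positive (k < K), the next coupling is the positive solution of (0.20).  Proof:
f2's `Step.couplingTrajectory_exists` (intermediate value theorem, run backwards from `g_K = g`) produces a trajectory in
`]0, γ]` with the discrete (0.31); forward uniqueness of (0.20) identifies it with `flowOf P (its g_0)`; the (0.31)
constants are `β = b / log L`, `β' = b' / log L` (`Step.logRunning_iff_discrete031`).  A REDUCTION: the lower bound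
`b > 0` is asserted by no printed source (cell MISSING.md §A1).  SCOPE (cell REFEREE R6.1 / R9.4, GAPS G-ref2-1): this is
the MARKOV typing — `β : ℕ → ℝ → ℝ`, `β_{k+1}` a function of `g_k` ALONE, as in `Step.RGEq`; B12 p. 298 prints that β_j
"depends also on all preceding coupling constants", and for that history-dependent family the statement quantifying over
all trajectories of a fixed β-map is the forward-shooting theorem `FlowStep.B12Thm2Shape_of_betaBoundsH` (module `FlowStep`
of this directory, cell seat strat-b12), which supersedes this one in scope. [cite: Balaban1987RG1, Thm 2 (0.31) p.259] -/
theorem B12Thm2Shape_of_betaBounds (L : ℕ) (hL : Odd L ∧ 1 < L) (flowOf : Params → ℝ → Flow)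
    (β : ℕ → ℝ → ℝ) {γ₀ b b' : ℝ} (hγ₀ : 0 < γ₀) (hb : 0 < b) (hbb' : b ≤ b')
    (hcont : ∀ j, ContinuousOn (β j) (Set.Ioc 0 γ₀))
    (hlo : Step.BetaLower b γ₀ β) (hup : Step.BetaUpper b' γ₀ β)
    (h0 : ∀ (P : Params) (g₀ : ℝ), (flowOf P g₀).g 0 = g₀)
    (hfwd : ∀ (P : Params) (g₀ : ℝ) (k : ℕ), k < P.K → 0 < (flowOf P g₀).g k →
      0 < 1 / ((flowOf P g₀).g k) ^ 2 - β (k + 1) ((flowOf P g₀).g k) →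
        0 < (flowOf P g₀).g (k + 1) ∧
          1 / ((flowOf P g₀).g (k + 1)) ^ 2 = 1 / ((flowOf P g₀).g k) ^ 2 - β (k + 1) ((flowOf P g₀).g k)) :
    B12Thm2Shape L hL flowOf := by
  intro m
  refine ⟨γ₀, hγ₀, fun γ hγ hγle => ⟨γ, hγ, fun g hg hgle => ?_⟩⟩
  -- the (0.31) constants in Bałaban's normalisation: `β log L = b`, `β' log L = b'`
  have hL1 : (1 : ℝ) < (L : ℝ) := by exact_mod_cast hL.2
  have hlog : 0 < Real.log (L : ℝ) := Real.log_pos hL1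
  refine ⟨b / Real.log L, b' / Real.log L, div_pos hb hlog,
    div_le_div_of_nonneg_right hbb' hlog.le, fun K => ?_⟩
  -- restrict the β-hypotheses from ]0, γ₀] to ]0, γ]
  have hcont' : ∀ j, ContinuousOn (β j) (Set.Ioc 0 γ) := fun j =>
    (hcont j).mono (Set.Ioc_subset_Ioc le_rfl hγle)
  have hlo' : Step.BetaLower b γ β := fun j x hx hxγ => hlo j x hx (hxγ.trans hγle)
  have hup' : Step.BetaUpper b' γ β := fun j x hx hxγ => hup j x hx (hxγ.trans hγle)
  obtain ⟨gs, hgsK, hrg, hI, hD⟩ :=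
    Step.couplingTrajectory_exists β hγ hb hbb' hcont' hlo' hup' K g hg hgle
  set P : Params := params4 L hL m K with hP
  have hPK : P.K = K := rfl
  have hPL : P.L = L := rfl
  refine ⟨gs 0, ?_⟩
  -- forward uniqueness: the construction's flow from `gs 0` IS the trajectory `gs` up to step `K`
  have agree : ∀ k, k ≤ K → (flowOf P (gs 0)).g k = gs k := by
    intro k
    induction k with
    | zero => intro _; exact h0 P (gs 0)
    | succ k ih =>
      intro hk
      have hkK : k < K := Nat.lt_of_succ_le hk
      have hgk : (flowOf P (gs 0)).g k = gs k := ih hkK.le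
      have hpos_k : 0 < gs k := (hI k hkK.le).1
      have hpos_k1 : 0 < gs (k + 1) := (hI (k + 1) hk).1
      have hrgk : 1 / (gs k) ^ 2 = 1 / (gs (k + 1)) ^ 2 + β (k + 1) (gs k) := hrg k hkK
      have hrhs : 0 < 1 / (gs k) ^ 2 - β (k + 1) (gs k) := by
        rw [hrgk, add_sub_cancel_right]; positivity
      obtain ⟨hpos', heq'⟩ := hfwd P (gs 0) k (hPK ▸ hkK) (hgk ▸ hpos_k) (by rw [hgk]; exact hrhs)
      rw [hgk, hrgk, add_sub_cancel_right] at heq'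
      -- `1/x² = 1/y²` with `x, y > 0` gives `x = y`
      have hsq : ((flowOf P (gs 0)).g (k + 1)) ^ 2 = (gs (k + 1)) ^ 2 := by
        have h1 : (((flowOf P (gs 0)).g (k + 1)) ^ 2)⁻¹ = ((gs (k + 1)) ^ 2)⁻¹ := by
          simpa only [one_div] using heq'
        exact inv_inj.mp h1
      exact (pow_left_inj₀ hpos'.le hpos_k1.le (by norm_num)).mp hsq
  refine ⟨?_, ?_, ?_⟩
  · -- interval condition
    intro k hk
    rw [agree k (hPK ▸ hk)]
    exact hI k (hPK ▸ hk)
  · -- renormalized coupling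
    rw [agree K le_rfl]; exact hgsK
  · -- (0.31): Setup's `LogRunning` is the discrete form with `b = β log L`, `b' = β' log L`
    rw [Step.logRunning_iff_discrete031, hPL, hPK, div_mul_cancel₀ b hlog.ne', div_mul_cancel₀ b' hlog.ne']
    intro k hk
    rw [agree k hk]
    exact hD k hk

end FlowReduction

/-! ## (v1.2) Regularity by instance: `[RegularGaugeGroup G]` discharges `hre`, `hre1`, `MeasurableMul₂/Inv`

After `UnitaryModel` (f1, p176168) the standing hypotheses of the sections above are fields of the Prop-mixin
`RegularGaugeGroup G` (`measurable_reTr`, `abs_reTr_le_one`; `MeasurableMul₂ G`, `MeasurableInv G` by `extends`), with instances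
for `Matrix.unitaryGroup n ℂ` and `Matrix.specialUnitaryGroup n ℂ`.  The primed versions take the mixin by instance search: for
Wilson's `SU(N)` theory and schemes of Wilson loops every hypothesis except `β_K ≥ 0` is gone. -/

section Regular

variable {G : Type*} [GaugeGroup G] [MeasurableSpace G] [RegularGaugeGroup G]

/-- `|W_γ| ≤ 1` on a regular gauge group (`|reTr| ≤ 1` is a field of the mixin). [folklore] -/
theorem abs_wilsonLoop_le_one' {P : Params} (U : GaugeField P 0 G) (γ : List (PathStep P)) :
    |wilsonLoop U γ| ≤ 1 :=
  RegularGaugeGroup.abs_reTr_le_one _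

/-- `|Re tr U(∂p)| ≤ 1` on a regular gauge group. [folklore] -/
theorem abs_plaqLoop_le_one {P : Params} (p : Plaq P 0) (U : GaugeField P 0 G) : |plaqLoop p U| ≤ 1 :=
  RegularGaugeGroup.abs_reTr_le_one _

/-- Wilson loop variables are measurable on a regular gauge group. [folklore] -/
theorem measurable_wilsonLoop' {P : Params} (γ : List (PathStep P)) :
    Measurable fun U : GaugeField P 0 G => wilsonLoop U γ :=
  measurable_wilsonLoop RegularGaugeGroup.measurable_reTr γ

/-- Plaquette observables are measurable on a regular gauge group. [folklore] -/
theorem measurable_plaqLoop' {P : Params} (p : Plaq P 0) : Measurable (plaqLoop (G := G) p) :=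
  measurable_plaqLoop RegularGaugeGroup.measurable_reTr p

variable [HaarData G]

/-- **`Z > 0`** for `β ≥ 0` on a regular gauge group. [folklore] -/
theorem partitionFn_pos' (P : Params) {β : ℝ} (hβ : 0 ≤ β) : 0 < partitionFn (G := G) P β :=
  partitionFn_pos RegularGaugeGroup.measurable_reTr P hβ

/-- **`|⟨F⟩| ≤ 1`** for `|F| ≤ 1`, `β ≥ 0`, on a regular gauge group. [folklore] -/
theorem abs_expect_le_one' (P : Params) {β : ℝ} (hβ : 0 ≤ β) {F : GaugeField P 0 G → ℝ}
    (hF1 : ∀ U, |F U| ≤ 1) : |expect (G := G) P β F| ≤ 1 :=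
  abs_expect_le_one RegularGaugeGroup.measurable_reTr P hβ hF1

/-- `|⟨W_γ⟩| ≤ 1` for every lattice loop, `β ≥ 0`, regular gauge group. [folklore] -/
theorem abs_expect_wilsonLoop_le_one (P : Params) {β : ℝ} (hβ : 0 ≤ β) (γ : List (PathStep P)) :
    |expect (G := G) P β (fun U => wilsonLoop U γ)| ≤ 1 :=
  abs_expect_le_one' P hβ fun U => abs_wilsonLoop_le_one' U γ

variable {O : Type*}

/-- Subsequential continuum limits for schemes of observables bounded by `1` over a regular gauge group, `β_K ≥ 0`
(`TorusScheme.hasSubseqContinuumLimit` with `hre` discharged by instance). [folklore] -/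
theorem TorusScheme.hasSubseqContinuumLimit' [Countable O] (S : TorusScheme G O) (hβ : ∀ K, 0 ≤ S.β K)
    (h1 : ∀ K o U, |S.obs K o U| ≤ 1) : HasSubseqContinuumLimit S :=
  S.hasSubseqContinuumLimit RegularGaugeGroup.measurable_reTr hβ h1

omit [HaarData G] in
/-- In a scheme OF WILSON LOOPS — every observable is `c · W_γ` for some lattice loop `γ` of the `K`-th lattice and some
constant `|c| ≤ 1` (no renormalisation constant larger than `1`) — all observables are bounded by `1`. [folklore] -/
theorem TorusScheme.abs_obs_le_one_of_wilsonLoops (S : TorusScheme G O)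
    (hW : ∀ K o, ∃ (c : ℝ) (γ : List (PathStep (S.P K))), |c| ≤ 1 ∧ ∀ U, S.obs K o U = c * wilsonLoop U γ)
    (K : ℕ) (o : O) (U : GaugeField (S.P K) 0 G) : |S.obs K o U| ≤ 1 := by
  obtain ⟨c, γ, hc, hobs⟩ := hW K o
  rw [hobs U, abs_mul]
  exact mul_le_one₀ hc (abs_nonneg _) (abs_wilsonLoop_le_one' U γ)

/-- **For schemes of Wilson loops over a regular gauge group with `β_K ≥ 0`, subsequential continuum limits of all joint
expectations exist** — no hypothesis on the lattice theory, on `reTr`, or on the observables is left (Jaffe–Witten's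
excluded "weak-existence (compactness)", fn. 2). [folklore] -/
theorem TorusScheme.hasSubseqContinuumLimit_of_wilsonLoops [Countable O] (S : TorusScheme G O)
    (hβ : ∀ K, 0 ≤ S.β K)
    (hW : ∀ K o, ∃ (c : ℝ) (γ : List (PathStep (S.P K))), |c| ≤ 1 ∧ ∀ U, S.obs K o U = c * wilsonLoop U γ) :
    HasSubseqContinuumLimit S :=
  S.hasSubseqContinuumLimit' hβ (S.abs_obs_le_one_of_wilsonLoops hW)

/-- **… and for such schemes the open content of the finite-torus continuum limit is uniqueness of the limit points**
(MRS p. 326: "the limit is not necessarily unique"). [folklore] -/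
theorem TorusScheme.hasContinuumLimit_iff_of_wilsonLoops [Countable O] (S : TorusScheme G O)
    (hβ : ∀ K, 0 ≤ S.β K)
    (hW : ∀ K o, ∃ (c : ℝ) (γ : List (PathStep (S.P K))), |c| ≤ 1 ∧ ∀ U, S.obs K o U = c * wilsonLoop U γ) :
    HasContinuumLimit S ↔ HasUniqueLimitPoints S :=
  S.hasContinuumLimit_iff_hasUniqueLimitPoints RegularGaugeGroup.measurable_reTr hβ
    (S.abs_obs_le_one_of_wilsonLoops hW)

end Regular

/-! ## (v1.2) What (0.31) forces along a trajectory: bounds on SUFFIX SUMS of the increments, not a pointwise bound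
(cell REFEREE.md R6.2 / GAPS G-ref2-2 — the witness is the cell referee's, re-typed here on an actual solution of (0.20))

Along a solution `g_0, …, g_K` of (0.20) the telescoped identity `1/g_k² = 1/g_K² + Σ_{j∈[k,K)} β_{j+1}(g_j)`
(`Step.inv_sq_telescope`) turns the discrete (0.31) (renormalized coupling `g = g_K`) into two-sided bounds on the suffix sums
of the increments `β_{j+1}(g_j)`.  These do NOT force `β_{j+1}(g_j) ≥ b` term by term (`discrete031_not_pointwise`).  Reading:
a uniform positive lower bound on the β-functions (`Step.BetaLower b`, the cell's (β-AF)) is SUFFICIENT for [Balaban1987RG1]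
Thm 2 (`B12Thm2Shape_of_betaBounds`); what the conclusion (0.31) itself forces is only the averaged statement. -/

section Suffix

/-- Along a solution of (0.20) up to `K`, the discrete (0.31) (with `g = g_K`) is EQUIVALENT to
`b (K − k) ≤ Σ_{j∈[k,K)} β_{j+1}(g_j) ≤ β' (K − k)` for every `k ≤ K`. [cite: Balaban1987RG1, (0.31) p.259] -/
theorem discrete031_iff_suffix_sums {K : ℕ} {β : ℕ → ℝ → ℝ} {g : ℕ → ℝ} (h : Step.RGEq K β g) (b β' : ℝ) :
    Step.Discrete031 b β' K (g K) g ↔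
      ∀ k, k ≤ K →
        b * ((K : ℝ) - k) ≤ ∑ j ∈ Finset.Ico k K, β (j + 1) (g j) ∧
          ∑ j ∈ Finset.Ico k K, β (j + 1) (g j) ≤ β' * ((K : ℝ) - k) := by
  unfold Step.Discrete031
  refine forall₂_congr fun k hk => ?_
  rw [Step.inv_sq_telescope h hk le_rfl]
  constructor
  · rintro ⟨h1, h2⟩; constructor <;> linarith
  · rintro ⟨h1, h2⟩; constructor <;> linarith

/-- The cell referee's witness (REFEREE.md R6.2), on an actual solution of (0.20): `K = 3`, constant β-functions
`β_1 ≡ 0`, `β_2 ≡ 3`, `β_3 ≡ 1`, inverse squared couplings `104, 104, 101, 100`.  The trajectory solves (0.20), lies in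
`]0, 1/10]`, satisfies the discrete (0.31) with `b = 1 > 0`, `β' = 3` — and its first increment `β_1(g_0) = 0` is below `b`.
So (0.31) does not force a pointwise positive lower bound on the β-functions along the trajectory. [folklore] -/
theorem discrete031_not_pointwise :
    ∃ (K : ℕ) (β : ℕ → ℝ → ℝ) (g : ℕ → ℝ) (b β' γ : ℝ), 0 < b ∧ b ≤ β' ∧ 0 < γ ∧
      Step.RGEq K β g ∧ Step.InInterval γ K g ∧ Step.Discrete031 b β' K (g K) g ∧
      ∃ j, j < K ∧ β (j + 1) (g j) < b := by
  -- inverse squared couplings `y k = 1/g_k²` and the constant β-functions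
  let y : ℕ → ℝ := fun k => if k = 0 then 104 else if k = 1 then 104 else if k = 2 then 101 else 100
  let β : ℕ → ℝ → ℝ := fun j _ => if j = 1 then 0 else if j = 2 then 3 else 1
  let g : ℕ → ℝ := fun k => 1 / Real.sqrt (y k)
  have hy : ∀ k, 100 ≤ y k := by
    intro k; simp only [y]; split_ifs <;> norm_num
  have hy0 : ∀ k, 0 < y k := fun k => lt_of_lt_of_le (by norm_num) (hy k)
  have hg2 : ∀ k, 1 / (g k) ^ 2 = y k := by
    intro k
    show 1 / (1 / Real.sqrt (y k)) ^ 2 = y k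
    rw [div_pow, one_pow, Real.sq_sqrt (hy0 k).le, one_div_one_div]
  have hgpos : ∀ k, 0 < g k := fun k => div_pos one_pos (Real.sqrt_pos.mpr (hy0 k))
  have hgle : ∀ k, g k ≤ 1 / 10 := by
    intro k
    have h10 : (10 : ℝ) ≤ Real.sqrt (y k) := by
      rw [show (10 : ℝ) = Real.sqrt (10 ^ 2) by rw [Real.sqrt_sq (by norm_num)]]
      exact Real.sqrt_le_sqrt (by linarith [hy k])
    exact one_div_le_one_div_of_le (by norm_num) h10
  refine ⟨3, β, g, 1, 3, 1 / 10, one_pos, by norm_num, by norm_num, ?_, ?_, ?_, ⟨0, by norm_num, ?_⟩⟩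
  · -- (0.20): `1/g_k² = 1/g_{k+1}² + β_{k+1}(g_k)` for k = 0, 1, 2
    intro k hk
    rw [hg2, hg2]
    interval_cases k <;> simp [y, β] <;> norm_num
  · -- the trajectory lies in ]0, 1/10]
    exact fun k _ => ⟨hgpos k, hgle k⟩
  · -- the discrete (0.31) with b = 1, β' = 3, K = 3, g = g_3
    intro k hk
    rw [hg2, hg2]
    interval_cases k <;> simp [y] <;> norm_num
  · -- the first increment vanishes
    show (if (0 + 1 = 1) then (0 : ℝ) else if (0 + 1 = 2) then 3 else 1) < 1
    norm_num

end Suffix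

/-! ## (v1.2) B14 (2.6), last inequality, as a condition on the partial sums (cell REFEREE.md R6.3 / GAPS G-ref2-3)

With `1/g_m² = 1/g_n² + Σ`, `Σ = Σ_{j∈[m,n)} β_{j+1}(g_j)` (`Step.inv_sq_telescope`):
`g_m ≤ (1+β₀) g_n ⇔ Σ ≥ −((1+β₀)² − 1)/g_m²`.  So the fourth inequality of [Balaban1988Convergent] (2.6) consumes a LOWER
bound on the partial sums of the β-functions; `β_j ≥ 0` suffices (`Step.B14_2_6d_of_betaNonneg`). -/

section PartialSum

/-- For `g_m, g_n > 0` with `1/g_m² = 1/g_n² + Σ` and `β₀ ≥ 0`:  `g_m ≤ (1+β₀) g_n ⇔ −((1+β₀)² − 1)/g_m² ≤ Σ`. [folklore] -/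
theorem le_mul_iff_partialSum_ge {gm gn S β₀ : ℝ} (hm : 0 < gm) (hn : 0 < gn) (hβ₀ : 0 ≤ β₀)
    (htel : 1 / gm ^ 2 = 1 / gn ^ 2 + S) :
    gm ≤ (1 + β₀) * gn ↔ -((1 + β₀) ^ 2 - 1) / gm ^ 2 ≤ S := by
  have hm2 : 0 < gm ^ 2 := by positivity
  have hn2 : 0 < gn ^ 2 := by positivity
  have key : gm ^ 2 / gn ^ 2 = 1 - gm ^ 2 * S := by
    rw [show gm ^ 2 / gn ^ 2 = gm ^ 2 * (1 / gn ^ 2) by ring,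
      show 1 / gn ^ 2 = 1 / gm ^ 2 - S by linarith, mul_sub, mul_one_div_cancel hm2.ne']
  calc gm ≤ (1 + β₀) * gn
      ↔ gm ^ 2 ≤ ((1 + β₀) * gn) ^ 2 := (pow_le_pow_iff_left₀ hm.le (by positivity) two_ne_zero).symm
    _ ↔ gm ^ 2 / gn ^ 2 ≤ (1 + β₀) ^ 2 := by rw [mul_pow, div_le_iff₀ hn2]
    _ ↔ 1 - gm ^ 2 * S ≤ (1 + β₀) ^ 2 := by rw [key]
    _ ↔ -((1 + β₀) ^ 2 - 1) ≤ S * gm ^ 2 := by constructor <;> intro h <;> linarith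
    _ ↔ -((1 + β₀) ^ 2 - 1) / gm ^ 2 ≤ S := by rw [div_le_iff₀ hm2]

/-- Hence, along a solution of (0.20) in `]0, γ]`: the fourth inequality of (2.6) between steps `m ≤ n ≤ K` holds iff the
partial sum `Σ_{j∈[m,n)} β_{j+1}(g_j)` is at least `−((1+β₀)² − 1)/g_m²`. [cite: Balaban1988Convergent, (2.6) p.255] -/
theorem B14_2_6d_iff_partialSum {K : ℕ} {β : ℕ → ℝ → ℝ} {g : ℕ → ℝ} {γ β₀ : ℝ} (h : Step.RGEq K β g)
    (hI : Step.InInterval γ K g) (hβ₀ : 0 ≤ β₀) {m n : ℕ} (hmn : m ≤ n) (hn : n ≤ K) :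
    g m ≤ (1 + β₀) * g n ↔ -((1 + β₀) ^ 2 - 1) / (g m) ^ 2 ≤ ∑ j ∈ Finset.Ico m n, β (j + 1) (g j) :=
  le_mul_iff_partialSum_ge (hI m (hmn.trans hn)).1 (hI n hn).1 hβ₀ (Step.inv_sq_telescope h hmn hn)

end PartialSum

end Literature.MathematicalPhysics.QuantumFieldTheory.Balaban1983to89.Missing
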